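import Summits.ABC.StewartYu.PadicG3Functions
import HarnessLib

/-!
# Cell abc-stewartyu, crux `Y07Odd` (stmt-ABC-19658), line `gen3-slab-odd`: the class functions at the HALF POINTS `s/2` —
# values on the principal square roots `psqrt(ω_j)` (Kummer half-step, part 1: inside `ℚ_p`)

`Summits/ABC/StewartYu/PadicG3HalfValues.lean` — cell `abc-stewartyu` (design HOME/p2/HALFSTEP-ODD.md; seat p2-g4, F-odd lead).  Theorems on
`G3Setup` for the generic family `(R, v)`; no named fact.  Twin of the first part of `PadicTwistPMHalfValues` (M2, provider B, any twist
order): at a half point `z = s/2` (`s ∈ ℤ`, in the frame odd) the exponential of the class family lies on the PRINCIPAL square roots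
`sq j := psqrt(ω_j)` of the twisted generators:

* `sq`, `sq_sq`, `norm_sq`;
* `exp_Lsum_half : exp(Lsum w · s/2) = ∏_j sq_j^{w_j s}` (signed exponents, `zpow`);
* `g3termΦ_half`, **`g3Φ_half`**: `φ_τ(s/2) = Σ_{i∈B} pᵢ · (Hasse_{t₀}Rᵢ)(s/2) · zγpow · ∏_j sq_j^{vᵢⱼ s}`.

Part 2 (`PadicG3HalfSplit`) reads this in `ℂ_p` with root data `sq_j = ŝ_j ξ^{r_j}`, `ŝ_j² = α_j`, and splits it along `ι = ξ^M` into the two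
signed parity class-sum vectors (`TwistHalf.sum_prod_twist_eq`); part 3 is the separation (`TwistHalf.norm_evL_add_iota_mul_ge`).

WHAT THIS IS NOT: no separation, no descent; no crux moves.

References: K. Yu, Compositio 74 (1990) (2.92)–(2.95); Yu. V. Nesterenko, LNM 1819 (2003) §4.3; cell memo HOME/p3/memo-05 §3 (PM).
-/

noncomputable section

open NormedSpace Finset Polynomial
open Literature.NumberTheory.Transcendental
open Literature.NumberTheory.Transcendental.CW77.Setup (Tau tauNorm)
open scoped Nat

namespace Summit.ABC.StewartYu

namespace G3Setup

variable {p : ℕ} [Fact p.Prime] (S : G3Setup p) {ι : Type*} (R : ι → ℚ[X]) (v : ι → Fin S.n → ℤ)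

/-! ### The principal square roots of the twisted generators -/

/-- `sq j := psqrt(ω_j) = exp(½ log ω_j)`, the principal square root of the principal unit `ω_j`. [cite: Yu1990, (2.92)] -/
def sq (j : Fin S.n) : ℚ_[p] := PadicExp.psqrt (S.ω j)

/-- `sq_j² = ω_j`. [cite: Yu1990, (2.92)] -/
theorem sq_sq (j : Fin S.n) : S.sq j ^ 2 = S.ω j := PadicExp.psqrt_sq S.hp3 (S.norm_one_sub_ω_le j)

/-- `‖sq_j‖ = 1`. [folklore] -/
theorem norm_sq (j : Fin S.n) : ‖S.sq j‖ = 1 := PadicExp.norm_psqrt S.hp3 (S.norm_one_sub_ω_le j)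

/-- `sq_j ≠ 0`. [folklore] -/
theorem sq_ne (j : Fin S.n) : S.sq j ≠ 0 := by
  have h := S.norm_sq j
  intro h0; rw [h0, norm_zero] at h; exact zero_ne_one h

/-- `‖½ log ω_j‖ ≤ p⁻¹`. [folklore] -/
theorem norm_half_lg_le (j : Fin S.n) : ‖(2 : ℚ_[p])⁻¹ * S.lg j‖ ≤ (p : ℝ)⁻¹ := by
  unfold lg
  rw [PadicExp.norm_inv_two_mul_plog S.hp3 (S.norm_one_sub_ω_le j)]
  exact S.norm_one_sub_ω_le j

/-- `exp(z · ½ log ω_j) = sq_j^z` for an integer `z`. [cite: Yu1990, (2.93)] -/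
theorem exp_intCast_mul_half_lg (j : Fin S.n) (z : ℤ) :
    exp ((z : ℚ_[p]) * ((2 : ℚ_[p])⁻¹ * S.lg j)) = S.sq j ^ z := by
  rw [PadicExp.exp_intCast_mul_of_norm_le S.hp3 (S.norm_half_lg_le j) z]
  rfl

/-- **`exp(Lsum w · s/2) = ∏_j sq_j^{w_j s}`** (signed exponents). [cite: Yu1990, (2.93)–(2.95)] -/
theorem exp_Lsum_half (w : Fin S.n → ℤ) (s : ℤ) :
    exp (S.Lsum w * ((2 : ℚ_[p])⁻¹ * (s : ℚ_[p]))) = ∏ j, S.sq j ^ (w j * s) := by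
  have e : S.Lsum w * ((2 : ℚ_[p])⁻¹ * (s : ℚ_[p])) = ∑ j, ((w j * s : ℤ) : ℚ_[p]) * ((2 : ℚ_[p])⁻¹ * S.lg j) := by
    unfold Lsum
    rw [sum_mul]
    refine sum_congr rfl fun j _ => ?_
    push_cast; ring
  rw [e, PadicExp.exp_sum_of_norm_le S.hp3 univ _ fun j _ => ?_]
  · exact prod_congr rfl fun j _ => S.exp_intCast_mul_half_lg j _
  · rw [norm_mul]
    exact (mul_le_of_le_one_left (norm_nonneg _) (Padic.norm_int_le_one _)).trans (S.norm_half_lg_le j)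

/-! ### The values at the half points -/

/-- One term at `s/2`: `(Hasse_{t₀}Rᵢ)(s/2) · zγpow · ∏_j sq_j^{vᵢⱼ s}`. [cite: Yu1990, (2.94)] -/
theorem g3termΦ_half (i : ι) (τ : Tau S.n) (s : ℤ) :
    S.g3termΦ R v i τ ((2 : ℚ_[p])⁻¹ * (s : ℚ_[p])) =
      (((hasseDeriv τ.1 (R i)).eval ((s : ℚ) / 2) * S.zγpow v i τ.2 : ℚ) : ℚ_[p]) * ∏ j, S.sq j ^ (v i j * s) := by
  unfold g3termΦ
  rw [S.exp_Lsum_half]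
  have hev : (hw (p := p) R i τ.1).eval ((2 : ℚ_[p])⁻¹ * (s : ℚ_[p])) =
      (((hasseDeriv τ.1 (R i)).eval ((s : ℚ) / 2) : ℚ) : ℚ_[p]) := by
    unfold hw
    rw [show ((2 : ℚ_[p])⁻¹ * (s : ℚ_[p])) = algebraMap ℚ ℚ_[p] ((s : ℚ) / 2) by rw [eq_ratCast]; push_cast; ring,
      Polynomial.eval_map, Polynomial.eval₂_at_apply, eq_ratCast]
  rw [hev]
  push_cast
  ring

/-- **The value of `φ_τ` at the half point `s/2`**: `Σ_{i∈B} pᵢ · (Hasse_{t₀}Rᵢ)(s/2) · zγpow · ∏_j sq_j^{vᵢⱼ s}`.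
[cite: Yu1990, (2.94)–(2.95)] -/
theorem g3Φ_half (B : Finset ι) (pv : ι → ℤ) (τ : Tau S.n) (s : ℤ) :
    S.g3Φ R v B pv τ ((2 : ℚ_[p])⁻¹ * (s : ℚ_[p])) =
      ∑ i ∈ B, (((pv i : ℚ) * ((hasseDeriv τ.1 (R i)).eval ((s : ℚ) / 2) * S.zγpow v i τ.2) : ℚ) : ℚ_[p]) *
        ∏ j, S.sq j ^ (v i j * s) := by
  unfold g3Φ
  refine sum_congr rfl fun i _ => ?_
  rw [S.g3termΦ_half R v i τ s]
  push_cast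
  ring

/-- At a half point the value has norm at most the largest coefficient norm (all `‖sq_j‖ = 1`, `pᵢ ∈ ℤ`, `‖zγpow‖ ≤ 1`).
[folklore] -/
theorem norm_g3Φ_half_le (B : Finset ι) (pv : ι → ℤ) (τ : Tau S.n) (s : ℤ) {Q : ℝ} (hQ0 : 0 ≤ Q)
    (hQ : ∀ i ∈ B, ‖((((hasseDeriv τ.1 (R i)).eval ((s : ℚ) / 2) : ℚ)) : ℚ_[p])‖ ≤ Q) :
    ‖S.g3Φ R v B pv τ ((2 : ℚ_[p])⁻¹ * (s : ℚ_[p]))‖ ≤ Q := by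
  rw [S.g3Φ_half R v B pv τ s]
  refine IsUltrametricDist.norm_sum_le_of_forall_le_of_nonneg hQ0 fun i hi => ?_
  have hu : ‖∏ j, S.sq j ^ (v i j * s)‖ = 1 := by
    rw [norm_prod]
    exact prod_eq_one fun j _ => by rw [norm_zpow, S.norm_sq, one_zpow]
  rw [norm_mul, hu, mul_one]
  push_cast
  rw [norm_mul, norm_mul]
  calc ‖(pv i : ℚ_[p])‖ * (‖((((hasseDeriv τ.1 (R i)).eval ((s : ℚ) / 2) : ℚ)) : ℚ_[p])‖ * ‖(S.zγpow v i τ.2 : ℚ_[p])‖)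
      ≤ 1 * (Q * 1) := by
        refine mul_le_mul (Padic.norm_int_le_one _) ?_ (by positivity) zero_le_one
        exact mul_le_mul (hQ i hi) (S.norm_zγpow_le v i τ.2) (norm_nonneg _) hQ0
    _ = Q := by ring

end G3Setup

end Summit.ABC.StewartYu

end
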